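import Literature.Barriers.QuantumAdvantage.AaronsonChenAdviceMaps
import Literature.Computability.Complexity.CHSums
import Literature.Computability.Complexity.PSpaceGapThreshold
import Literature.Computability.Complexity.SpaceTMSATHard
import HarnessLib

/-!
# Aaronson–Chen 2017, Lemma 5.3: the advice language is in `PSPACE` given the two physical predicates; Lemma 5.3 from them

Conclusion of `AaronsonChenAdviceMaps.lean` on `AcProto.advLang ∈ PSPACE` — the printed "all the
computations can be done in `PSPACE`" ([AaronsonChen2017, §5.3 p. 23]) reduced to the two physical
predicates `HeavyLang`/`CdfLang` of `AaronsonChenAdvice.lean` — in two parts, each with its own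
summary below:

1. `AaronsonChenAdviceLearn` — the learning phase: the rank condition "the `s`-th queried string" as a
   gap threshold over `PSPACE` witness relations (`PSpaceGapThreshold.lean`), **`LearnLang ∈ PSPACE`**
   and `mem_LearnLang_iff`;
2. `AaronsonChenAdvicePSPACE` — the sampling and output phases (`SampLang`, `OutLang`: the least
   selected label and its post-processed block), the decomposition `advLang_eq_advDecomp`,
   **`advLang_mem_PSPACE`** (given `HeavyLang, CdfLang ∈ PSPACE`), and
   **`aaronsonChen2017_lem53_of_physics`**: `aaronsonChen2017_lem53` from `IsHard PSPACE TQBF` and the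
   `PSPACE`-membership of the two physical predicates for bounded protocol data, through
   `aaronsonChen2017_lem53_of_advice` (`AaronsonChenMachine.lean`).

No named facts (net debt 0).

## References

* [AaronsonChen2017] S. Aaronson, L. Chen, CCC 2017 (arXiv:1612.05903), Lemma 5.3 and §5.3
  (pp. 21–23), read via `lit read arxiv:1612.05903 --pages 19-25`.
* [FennerFortnowKurtz1994] Prop. 4.2 (gap thresholds), as used in `PSpaceGapThreshold.lean`.
* [KnuthTAOCP2] §3.4.1 A (the inversion method), as in `InverseCdfSampling.lean`.
* [AroraBarakCC2009] Thm. 4.2/§4.1–4.2 (closure of `PSPACE`), Thm. 4.13 (`TQBF` is `PSPACE`-complete).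
-/

/-! ## Part 1 (`AaronsonChenAdviceLearn`): Aaronson–Chen 2017, Lemma 5.3: the learning phase of the advice language is in `PSPACE` given `HeavyLang`

Second of three files on `AcProto.advLang ∈ PSPACE` (see `AaronsonChenAdviceMaps.lean`). The
learning-phase bit on `inst = ⟨w, ⟨h, ⟨1ⁿ, ⟨1ˢ, 1ᵇ⟩⟩⟩⟩` is (by `AcProto.advBit_eq_true_iff`,
`AaronsonChenAdvice.lean`): "some string `u` queried at stage `n` (history `h`) with EXACTLY `s` queried
strings of smaller numeral value has bit `b` of its padded block `0^p 1 u` set" — the simulator spells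
the `s`-th queried string. Over instances `y = ⟨inst, u⟩` (accessors `wY`, `hY`, `νY`, `σY`, `βY`):

* `gH ⁻¹' HeavyLang` — `u` is queried (`gH y = ⟨w, ⟨h, ⟨ν, u⟩⟩⟩`);
* the RANK CONDITION as a gap threshold (`Complexity/PSpaceGapThreshold.lean`,
  `gapThreshold_mem_PSPACE`: `{1 < 2(#₁ − #₂)} ∈ PSPACE` for `PSPACE` witness relations): `#₁` counts
  the witnesses of `LessRel` (`AaronsonChenAdvice.lean`: queried strings below `u`, zero-padded —
  `LessRel_eq`: a `P` test `LessP` met with a `HeavyLang` query, so `LessRel ∈ PSPACE`;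
  `countWitnesses_LessRel`), `#₂` those of the filler `ThetaRel = {⟨cv, Y⟩ | ⟦Y⟧ < |τ|}` (exactly `|τ|`,
  `countWitnesses_ThetaRel`, `cnt_val_lt`); `TLang` and `mem_TLang_iff` (`cv ∈ T ↔ |τ| < #{queried u' < u}`),
  `GEs`/`GEs1` ("at least / more than `|σ|` below") and their semantics;
* `PadBit ∈ P` (bit `|β|` of `padBlock W u`), `ALang = HeavyPre ∩ (GEs ∩ GEs1ᶜ) ∩ PadBit`,
  **`LearnLang`** `= ∃ᵖ u · ALang` ∈ `PSPACE` (`LearnLang_mem_PSPACE`) and its semantics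
  **`mem_LearnLang_iff`** (under `IsBounded`, for slot indices below `S`).

## References

* [AaronsonChen2017] arXiv:1612.05903, §5.3 (p. 22: "we query all x with Q(x) ≥ τ"; p. 23).
* [FennerFortnowKurtz1994] Prop. 4.2 (gap thresholds), as used in `PSpaceGapThreshold.lean`.
-/

noncomputable section

namespace Literature.Barriers.QuantumAdvantage

open MeasureTheory _root_.Computability Polynomial Literature.Computability.Complexity
  Literature.Computability.Complexity.Brick Literature.Computability.Complexity.Plumb
  Literature.Computability.Complexity.OracleCompose Literature.Computability.Complexity.PRelSigma
  Literature.Computability.Complexity.TTClosure Literature.Computability.Complexity.StrEq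
  Literature.Computability.Cryptography

namespace AcProto

variable (P : AcProto)

/-! ### The learning phase: instances `y = ⟨inst, u⟩`, `inst = ⟨w, ⟨h, ⟨ν, ⟨σ, β⟩⟩⟩⟩` -/

section Learn

/-- `w` of `⟨inst, u⟩`. [folklore] -/
def wY : List Bool → List Bool := fstP ∘ fstP
/-- `h` of `⟨inst, u⟩`. [folklore] -/
def hY : List Bool → List Bool := fstP ∘ sndP ∘ fstP
/-- `ν` of `⟨inst, u⟩`. [folklore] -/
def νY : List Bool → List Bool := fstP ∘ sndP ∘ sndP ∘ fstP
/-- `σ` of `⟨inst, u⟩`. [folklore] -/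
def σY : List Bool → List Bool := fstP ∘ sndP ∘ sndP ∘ sndP ∘ fstP
/-- `β` of `⟨inst, u⟩`. [folklore] -/
def βY : List Bool → List Bool := sndP ∘ sndP ∘ sndP ∘ sndP ∘ fstP
/-- `1^{W(wl)}` of `⟨inst, u⟩`, the block width of the schedule of `w`. [folklore] -/
def WY : List Bool → List Bool := polyFn P.WdP ∘ pairFn (fstP ∘ wY) (sndP ∘ wY)

/-- `wY ∈ FP`. [folklore] -/
theorem wY_mem_FP : wY ∈ FP := comp_mem_FP fstP_mem_FP fstP_mem_FP
/-- `hY ∈ FP`. [folklore] -/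
theorem hY_mem_FP : hY ∈ FP := comp_mem_FP fstP_mem_FP (comp_mem_FP sndP_mem_FP fstP_mem_FP)
/-- `νY ∈ FP`. [folklore] -/
theorem νY_mem_FP : νY ∈ FP := comp_mem_FP fstP_mem_FP (comp_mem_FP sndP_mem_FP (comp_mem_FP sndP_mem_FP fstP_mem_FP))
/-- `σY ∈ FP`. [folklore] -/
theorem σY_mem_FP : σY ∈ FP :=
  comp_mem_FP fstP_mem_FP (comp_mem_FP sndP_mem_FP (comp_mem_FP sndP_mem_FP (comp_mem_FP sndP_mem_FP fstP_mem_FP)))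
/-- `βY ∈ FP`. [folklore] -/
theorem βY_mem_FP : βY ∈ FP :=
  comp_mem_FP sndP_mem_FP (comp_mem_FP sndP_mem_FP (comp_mem_FP sndP_mem_FP (comp_mem_FP sndP_mem_FP fstP_mem_FP)))
/-- `WY ∈ FP`. [folklore] -/
theorem WY_mem_FP : P.WY ∈ FP :=
  comp_mem_FP (polyFn_mem_FP _) (pairFn_mem_FP (comp_mem_FP fstP_mem_FP wY_mem_FP) (comp_mem_FP sndP_mem_FP wY_mem_FP))

variable (w h ν σ β u : List Bool)

/-- Value of `wY` on a well-formed instance. [folklore] -/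
@[simp] theorem wY_apply : wY (boolPair (boolPair w (boolPair h (boolPair ν (boolPair σ β)))) u) = w := by simp [wY]
/-- Value of `hY` on a well-formed instance. [folklore] -/
@[simp] theorem hY_apply : hY (boolPair (boolPair w (boolPair h (boolPair ν (boolPair σ β)))) u) = h := by simp [hY]
/-- Value of `νY` on a well-formed instance. [folklore] -/
@[simp] theorem νY_apply : νY (boolPair (boolPair w (boolPair h (boolPair ν (boolPair σ β)))) u) = ν := by simp [νY]
/-- Value of `σY` on a well-formed instance. [folklore] -/
@[simp] theorem σY_apply : σY (boolPair (boolPair w (boolPair h (boolPair ν (boolPair σ β)))) u) = σ := by simp [σY]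
/-- Value of `βY` on a well-formed instance. [folklore] -/
@[simp] theorem βY_apply : βY (boolPair (boolPair w (boolPair h (boolPair ν (boolPair σ β)))) u) = β := by simp [βY]
/-- Value of `WY` on a well-formed instance. [folklore] -/
@[simp] theorem WY_apply : P.WY (boolPair (boolPair w (boolPair h (boolPair ν (boolPair σ β)))) u) =
    ones (P.Wd (wl (fstP w) (sndP w))) := by
  simp [WY, wl]

end Learn

section LearnLang

/-- Raw values of the accessors. [folklore] -/
theorem wY_eq (y : List Bool) : wY y = (boolUnpair (boolUnpair y).1).1 := rfl
/-- Raw values of the accessors. [folklore] -/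
theorem hY_eq (y : List Bool) : hY y = (boolUnpair (boolUnpair (boolUnpair y).1).2).1 := rfl
/-- Raw values of the accessors. [folklore] -/
theorem νY_eq (y : List Bool) : νY y = (boolUnpair (boolUnpair (boolUnpair (boolUnpair y).1).2).2).1 := rfl
/-- Raw values of the accessors. [folklore] -/
theorem σY_eq (y : List Bool) : σY y = (boolUnpair (boolUnpair (boolUnpair (boolUnpair (boolUnpair y).1).2).2).2).1 := rfl
/-- Raw values of the accessors. [folklore] -/
theorem βY_eq (y : List Bool) : βY y = (boolUnpair (boolUnpair (boolUnpair (boolUnpair (boolUnpair y).1).2).2).2).2 := rfl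

/-- The `HeavyLang` instance `⟨w, ⟨h, ⟨ν, u⟩⟩⟩` of `⟨inst, u⟩`. [folklore] -/
def gH : List Bool → List Bool := pairFn wY (pairFn hY (pairFn νY sndP))

/-- `gH ∈ FP`. [folklore] -/
theorem gH_mem_FP : gH ∈ FP := pairFn_mem_FP wY_mem_FP (pairFn_mem_FP hY_mem_FP (pairFn_mem_FP νY_mem_FP sndP_mem_FP))

/-- The counting instance `⟨w, ⟨h, ⟨ν, ⟨u, τ⟩⟩⟩⟩` of `⟨inst, u⟩`, threshold `τ = τf ⟨inst, u⟩`. [folklore] -/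
def cvOf (τf : List Bool → List Bool) : List Bool → List Bool := pairFn wY (pairFn hY (pairFn νY (pairFn sndP τf)))

/-- `cvOf τf ∈ FP`. [folklore] -/
theorem cvOf_mem_FP {τf : List Bool → List Bool} (hτ : τf ∈ FP) : cvOf τf ∈ FP :=
  pairFn_mem_FP wY_mem_FP (pairFn_mem_FP hY_mem_FP (pairFn_mem_FP νY_mem_FP (pairFn_mem_FP sndP_mem_FP hτ)))

/-- **The filler relation** `ThetaRel = {⟨cv, Y⟩ | ⟦Y⟧ < |τ|}` (`τ` the last field of `cv`): exactly
`|τ|` witnesses of each length `≥ log |τ|`. [folklore] -/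
def ThetaRel : Language Bool := pairFn βY (binToUnaryFn ∘ pairFn βY sndP) ⁻¹' LenLt X

/-- Membership in `ThetaRel`. [folklore] -/
theorem mem_ThetaRel_iff (q : List Bool) : q ∈ ThetaRel ↔ bitsToNat (sndP q) < (βY q).length := by
  unfold ThetaRel
  rw [memL_preimage, pairFn_apply, boolPair_mem_LenLt, Function.comp_apply, pairFn_apply, binToUnaryFn_boolPair,
    length_ones_eq, eval_X]
  exact min_lt_iff.trans ⟨fun h => h.resolve_right (lt_irrefl _), Or.inl⟩

/-- `ThetaRel ∈ P`. [folklore] -/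
theorem ThetaRel_mem_P : ThetaRel ∈ Classes.P :=
  preimage_mem_P (LenLt_mem_P _) (pairFn_mem_FP βY_mem_FP (comp_mem_FP binToUnaryFn_mem_FP (pairFn_mem_FP βY_mem_FP sndP_mem_FP)))

/-- **The filler relation has exactly `|τ|` witnesses** of length `m` when `|τ| ≤ 2^m`. [folklore] -/
theorem countWitnesses_ThetaRel (w h ν u τ : List Bool) {m : ℕ} (hτ : τ.length ≤ 2 ^ m) :
    countWitnesses ThetaRel m (boolPair w (boolPair h (boolPair ν (boolPair u τ)))) = τ.length := by
  rw [PPSharpP.countWitnesses_eq_cnt]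
  have : {y : List Bool | boolPair (boolPair w (boolPair h (boolPair ν (boolPair u τ)))) y ∈ ThetaRel} =
      {y | bitsToNat y < τ.length} := by
    ext y
    rw [Set.mem_setOf_eq, mem_ThetaRel_iff]
    simp [βY]
  rw [this, cnt_val_lt hτ]

/-- The `HeavyLang` instance `⟨w, ⟨h, ⟨ν, Y ↾ |u|⟩⟩⟩` of a counting pair `⟨cv, Y⟩`. [folklore] -/
def gL : List Bool → List Bool := pairFn wY (pairFn hY (pairFn νY (takeFn ∘ pairFn σY sndP)))

/-- `gL ∈ FP`. [folklore] -/
theorem gL_mem_FP : gL ∈ FP :=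
  pairFn_mem_FP wY_mem_FP (pairFn_mem_FP hY_mem_FP (pairFn_mem_FP νY_mem_FP (comp_mem_FP takeFn_mem_FP
    (pairFn_mem_FP σY_mem_FP sndP_mem_FP))))

/-- The polynomial-time part of `LessRel`: the witness is zero beyond `|u|` and its prefix is of
smaller numeral value than `u`. [folklore] -/
def LessP : Language Bool :=
  ((dropFn ∘ pairFn σY sndP) ⁻¹' NoBit true) ⊓ {q | ltFn (pairFn (takeFn ∘ pairFn σY sndP) σY q) = [true]}

/-- `LessP ∈ P`. [folklore] -/
theorem LessP_mem_P : LessP ∈ Classes.P := by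
  refine inter_mem_P (preimage_mem_P (NoBit_mem_P true) (comp_mem_FP dropFn_mem_FP (pairFn_mem_FP σY_mem_FP sndP_mem_FP))) ?_
  refine mem_P_of_mem_FP (comp_mem_FP ltFn_mem_FP (pairFn_mem_FP (comp_mem_FP takeFn_mem_FP
    (pairFn_mem_FP σY_mem_FP sndP_mem_FP)) σY_mem_FP)) _ fun q => ⟨fun h => h, fun h => ?_⟩
  have h' : ¬ ltFn (pairFn (takeFn ∘ pairFn σY sndP) σY q) = [true] := h
  simp only [Function.comp_apply, pairFn_apply, ltFn_boolPair] at h' ⊢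
  simpa using h'

/-- Membership in `LessP`. [folklore] -/
theorem mem_LessP_iff (q : List Bool) :
    q ∈ LessP ↔ true ∉ (sndP q).drop (σY q).length ∧ bitsToNat ((sndP q).take (σY q).length) < bitsToNat (σY q) := by
  change true ∉ dropFn (pairFn σY sndP q) ∧ ltFn (pairFn (takeFn ∘ pairFn σY sndP) σY q) = [true] ↔ _
  simp only [Function.comp_apply, pairFn_apply, dropFn_boolPair, takeFn_boolPair, ltFn_boolPair, List.cons.injEq,
    and_true, decide_eq_true_eq]

/-- Value of `gL`. [folklore] -/
theorem gL_apply (q : List Bool) :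
    gL q = boolPair (wY q) (boolPair (hY q) (boolPair (νY q) ((sndP q).take (σY q).length))) := by
  simp [gL, pairFn_apply]

/-- **`LessRel` is a `P` condition met with a `HeavyLang` query.** [folklore] -/
theorem LessRel_eq : P.LessRel = LessP ⊓ gL ⁻¹' P.HeavyLang := by
  ext q
  rw [show q ∈ LessP ⊓ gL ⁻¹' P.HeavyLang ↔ q ∈ LessP ∧ gL q ∈ P.HeavyLang from Iff.rfl, mem_LessP_iff, gL_apply,
    mem_HeavyLang_iff]
  change P.LessRelP _ _ _ _ _ _ ↔ _
  unfold LessRelP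
  simp only [wY_eq, hY_eq, νY_eq, σY_eq]
  constructor
  · rintro ⟨hz, hlt, hm⟩
    exact ⟨⟨fun ht => absurd (hz true ht) (by decide), hlt⟩, hm⟩
  · rintro ⟨⟨hz, hlt⟩, hm⟩
    refine ⟨fun b hb => ?_, hlt, hm⟩
    cases b
    · rfl
    · exact absurd hb hz

/-- **`LessRel ∈ PSPACE`** when `HeavyLang` is. [folklore] -/
theorem LessRel_mem_PSPACE (hH : P.HeavyLang ∈ PSPACE) : P.LessRel ∈ PSPACE := by
  rw [LessRel_eq]
  exact inter_P_mem_PSPACE LessP_mem_P (preimage_mem_PSPACE hH gL_mem_FP)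

variable {B : Language Bool}

/-- Witness-length polynomial of the counting: `W(n + 2)` (room for any queried string of the schedule
of a `w` of length `≤ n`). [folklore] -/
def r₁P : Polynomial ℕ := P.WdP.comp (X + 2)

/-- Filler-length polynomial: `S(n + 2) + 1` (so that `2^{r₂} > ` any slot index). [folklore] -/
def r₂P : Polynomial ℕ := P.SmP.comp (X + 2) + 1

/-- **The threshold language** `T = {cv | #LessRel(cv) > #ThetaRel(cv)}` (a gap threshold with
`p = 0`: `1 < 2(#₁ − #₂)`), i.e. "more than `|τ|` queried strings below `u`". [folklore] -/
def TLang : Language Bool :=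
  {cv | (2 : ℤ) ^ (0 : Polynomial ℕ).eval (fstP cv).length <
    2 * ((countWitnesses P.LessRel (P.r₁P.eval (fstP cv).length) cv : ℤ) -
      (countWitnesses ThetaRel (P.r₂P.eval (fstP cv).length) cv : ℤ))}

/-- **`T ∈ PSPACE`** (`gapThreshold_mem_PSPACE`). [cite: FennerFortnowKurtz1994, Proposition 4.2] -/
theorem TLang_mem_PSPACE (hB : IsComplete PSPACE B) (hH : P.HeavyLang ∈ PSPACE) : P.TLang ∈ PSPACE :=
  gapThreshold_mem_PSPACE hB (P.LessRel_mem_PSPACE hH) (P_subset_PSPACE_holds ThetaRel_mem_P) _ _ _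

/-- `wl ≤ |w| + 2`: the schedule length of `w = ⟨x₀, r⟩` read off any `w`. [folklore] -/
theorem wl_le (w : List Bool) : wl (boolUnpair w).1 (boolUnpair w).2 ≤ w.length + 2 := by
  have := length_boolUnpair_parts_le w
  rw [wl, length_boolPair]
  omega

/-- `Wd` is monotone. [folklore] -/
theorem Wd_mono {m n : ℕ} (h : m ≤ n) : P.Wd m ≤ P.Wd n := by
  unfold Wd; have := TM2Iter.eval_mono P.pF h; omega

/-- `Sm` is monotone. [folklore] -/
theorem Sm_mono {m n : ℕ} (h : m ≤ n) : P.Sm m ≤ P.Sm n := by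
  unfold Sm
  exact Nat.mul_le_mul_left 2 (Nat.pow_le_pow_left (by have := TM2Iter.eval_mono P.pF h; omega) _)

/-- **Semantics of `T`**: for a queried `u` (so that all smaller queried strings have its length,
which fits the witness length) and a threshold below `2^{r₂}`, `cv ∈ T ↔ |τ| < #{queried u' < u}`.
[folklore] -/
theorem mem_TLang_iff (hP : P.IsBounded) (w h ν u τ : List Bool)
    (hu : u ∈ P.stageList (boolUnpair w).1 (P.tabsOf (boolUnpair w).1 (boolUnpair w).2 h) ν.length)
    (hτ : τ.length ≤ P.Sm (wl (boolUnpair w).1 (boolUnpair w).2)) :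
    boolPair w (boolPair h (boolPair ν (boolPair u τ))) ∈ P.TLang ↔
      τ.length < P.cntLess (boolUnpair w).1 (boolUnpair w).2 h ν.length u := by
  have hul : u.length ≤ P.r₁P.eval w.length := by
    have h1 := P.length_lt_of_mem_stageList hu
    have h2 := nq_lt_Wd hP (boolUnpair w).1 (boolUnpair w).2
    have h3 := P.Wd_mono (wl_le w)
    simp only [r₁P, eval_comp, eval_add, eval_X, eval_ofNat, eval_WdP]
    omega
  have hτ' : τ.length ≤ 2 ^ P.r₂P.eval w.length := by
    have h1 := P.Sm_mono (wl_le w)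
    simp only [r₂P, eval_add, eval_comp, eval_X, eval_ofNat, eval_one, eval_SmP]
    exact (hτ.trans h1).trans ((Nat.le_succ _).trans (Nat.lt_two_pow_self).le)
  change (2 : ℤ) ^ (0 : Polynomial ℕ).eval (fstP (boolPair w (boolPair h (boolPair ν (boolPair u τ))))).length < _ ↔ _
  rw [fstP_boolPair, P.countWitnesses_LessRel w h ν u τ hul hu, countWitnesses_ThetaRel w h ν u τ hτ']
  simp only [eval_zero, pow_zero]
  omega

/-- **"At least `|σ|` queried strings below `u`"** on `y = ⟨inst, u⟩`: `σ = ε`, or `T` with threshold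
`|σ| − 1`. [folklore] -/
def GEs : Language Bool := {y | σY y = []} ⊔ (cvOf (List.tail ∘ σY)) ⁻¹' P.TLang

/-- **"More than `|σ|` queried strings below `u`"**: `T` with threshold `|σ|`. [folklore] -/
def GEs1 : Language Bool := (cvOf σY) ⁻¹' P.TLang

/-- `GEs ∈ PSPACE`. [folklore] -/
theorem GEs_mem_PSPACE (hB : IsComplete PSPACE B) (hH : P.HeavyLang ∈ PSPACE) : P.GEs ∈ PSPACE := by
  refine union_P_mem_PSPACE ?_ (preimage_mem_PSPACE (P.TLang_mem_PSPACE hB hH)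
    (cvOf_mem_FP (comp_mem_FP PRelSigma.tail_mem_FP σY_mem_FP)))
  refine mem_P_of_mem_FP (comp_mem_FP isNilFn_mem_FP σY_mem_FP) _ fun y => ⟨fun h => ?_, fun h => ?_⟩
  · have h' : σY y = [] := h
    simp [isNilFn, h']
  · have h' : ¬ σY y = [] := h
    simp [isNilFn, h']

/-- `GEs1 ∈ PSPACE`. [folklore] -/
theorem GEs1_mem_PSPACE (hB : IsComplete PSPACE B) (hH : P.HeavyLang ∈ PSPACE) : P.GEs1 ∈ PSPACE :=
  preimage_mem_PSPACE (P.TLang_mem_PSPACE hB hH) (cvOf_mem_FP σY_mem_FP)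

variable (w h ν σ β u : List Bool)

/-- Value of `cvOf`. [folklore] -/
theorem cvOf_apply (τf : List Bool → List Bool) :
    cvOf τf (boolPair (boolPair w (boolPair h (boolPair ν (boolPair σ β)))) u) =
      boolPair w (boolPair h (boolPair ν (boolPair u (τf (boolPair (boolPair w (boolPair h (boolPair ν (boolPair σ β)))) u))))) := by
  simp [cvOf, wY, hY, νY]

/-- Value of `gH`. [folklore] -/
theorem gH_apply : gH (boolPair (boolPair w (boolPair h (boolPair ν (boolPair σ β)))) u) =
    boolPair w (boolPair h (boolPair ν u)) := by
  simp [gH, wY, hY, νY]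

/-- Semantics of `GEs`. [folklore] -/
theorem mem_GEs_iff (hP : P.IsBounded)
    (hu : u ∈ P.stageList (boolUnpair w).1 (P.tabsOf (boolUnpair w).1 (boolUnpair w).2 h) ν.length)
    (hσ : σ.length ≤ P.Sm (wl (boolUnpair w).1 (boolUnpair w).2)) :
    boolPair (boolPair w (boolPair h (boolPair ν (boolPair σ β)))) u ∈ P.GEs ↔
      σ.length ≤ P.cntLess (boolUnpair w).1 (boolUnpair w).2 h ν.length u := by
  change σY _ = [] ∨ cvOf (List.tail ∘ σY) _ ∈ P.TLang ↔ _
  rw [cvOf_apply, σY_apply, Function.comp_apply, σY_apply,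
    P.mem_TLang_iff hP w h ν u σ.tail hu (by rw [List.length_tail]; omega), List.length_tail]
  constructor
  · rintro (h | h)
    · rw [h]; exact Nat.zero_le _
    · omega
  · intro h
    cases σ with
    | nil => exact Or.inl rfl
    | cons b σ => right; simp at h ⊢; omega

/-- Semantics of `GEs1`. [folklore] -/
theorem mem_GEs1_iff (hP : P.IsBounded)
    (hu : u ∈ P.stageList (boolUnpair w).1 (P.tabsOf (boolUnpair w).1 (boolUnpair w).2 h) ν.length)
    (hσ : σ.length ≤ P.Sm (wl (boolUnpair w).1 (boolUnpair w).2)) :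
    boolPair (boolPair w (boolPair h (boolPair ν (boolPair σ β)))) u ∈ P.GEs1 ↔
      σ.length < P.cntLess (boolUnpair w).1 (boolUnpair w).2 h ν.length u := by
  change cvOf σY _ ∈ P.TLang ↔ _
  rw [cvOf_apply, σY_apply, P.mem_TLang_iff hP w h ν u σ hu hσ]

/-- **The padded-block bit** on `y = ⟨inst, u⟩`: bit `|β|` of `padBlock W u` is set. [folklore] -/
def PadBit : Language Bool := {y | (padFn P.WY sndP y).getD (βY y).length false = true}

/-- `PadBit ∈ P`. [folklore] -/
theorem PadBit_mem_P : P.PadBit ∈ Classes.P := setOf_getD_mem_P βY_mem_FP (padFn_mem_FP P.WY_mem_FP sndP_mem_FP)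

/-- Semantics of `PadBit`. [folklore] -/
theorem mem_PadBit_iff : boolPair (boolPair w (boolPair h (boolPair ν (boolPair σ β)))) u ∈ P.PadBit ↔
    (padBlock (P.Wd (wl (boolUnpair w).1 (boolUnpair w).2)) u).getD β.length false = true := by
  change (padFn P.WY sndP _).getD (βY _).length false = true ↔ _
  rw [padFn_apply, WY_apply, βY_apply, sndP_boolPair, length_ones_eq]
  rfl

/-- **The learning relation** `A = HeavyPre ∩ (GEs ∩ GEs1ᶜ) ∩ PadBit` on `⟨inst, u⟩`. [folklore] -/
def ALang : Language Bool := gH ⁻¹' P.HeavyLang ⊓ ((P.GEs ⊓ (P.GEs1)ᶜ) ⊓ P.PadBit)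

/-- `A ∈ PSPACE`. [folklore] -/
theorem ALang_mem_PSPACE (hB : IsComplete PSPACE B) (hH : P.HeavyLang ∈ PSPACE) : P.ALang ∈ PSPACE :=
  inter_mem_PSPACE_of_complete hB (preimage_mem_PSPACE hH gH_mem_FP)
    (inter_mem_PSPACE_of_complete hB (inter_mem_PSPACE_of_complete hB (P.GEs_mem_PSPACE hB hH)
      (compl_mem_PSPACE (P.GEs1_mem_PSPACE hB hH))) (P_subset_PSPACE_holds P.PadBit_mem_P))

/-- **The learning-phase bit language** on `inst = ⟨w, ⟨h, ⟨ν, ⟨σ, β⟩⟩⟩⟩`: some queried `u` of stage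
`|ν|` with exactly `|σ|` smaller queried strings has bit `|β|` of its padded block set. [folklore] -/
def LearnLang : Language Bool :=
  {inst | ∃ u : List Bool, u.length ≤ P.r₁P.eval inst.length ∧ boolPair inst u ∈ P.ALang}

/-- **`LearnLang ∈ PSPACE`** (bounded `∃` over `A`). [folklore] -/
theorem LearnLang_mem_PSPACE (hB : IsComplete PSPACE B) (hH : P.HeavyLang ∈ PSPACE) : P.LearnLang ∈ PSPACE :=
  polyExists_mem_PSPACE (P.ALang_mem_PSPACE hB hH) _

/-- **Semantics of `LearnLang`.** [folklore] -/
theorem mem_LearnLang_iff (hP : P.IsBounded) (hσ : σ.length + 1 ≤ P.Sm (wl (boolUnpair w).1 (boolUnpair w).2)) :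
    boolPair w (boolPair h (boolPair ν (boolPair σ β))) ∈ P.LearnLang ↔
      ∃ u, u ∈ P.stageList (boolUnpair w).1 (P.tabsOf (boolUnpair w).1 (boolUnpair w).2 h) ν.length ∧
        P.cntLess (boolUnpair w).1 (boolUnpair w).2 h ν.length u = σ.length ∧
        (padBlock (P.Wd (wl (boolUnpair w).1 (boolUnpair w).2)) u).getD β.length false = true := by
  change (∃ u : List Bool, u.length ≤ P.r₁P.eval (boolPair w (boolPair h (boolPair ν (boolPair σ β)))).length ∧
    boolPair _ u ∈ P.ALang) ↔ _
  refine exists_congr fun u => ?_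
  have hA : boolPair (boolPair w (boolPair h (boolPair ν (boolPair σ β)))) u ∈ P.ALang ↔
      boolPair w (boolPair h (boolPair ν u)) ∈ P.HeavyLang ∧
        (boolPair (boolPair w (boolPair h (boolPair ν (boolPair σ β)))) u ∈ P.GEs ∧
          boolPair (boolPair w (boolPair h (boolPair ν (boolPair σ β)))) u ∉ P.GEs1) ∧
        boolPair (boolPair w (boolPair h (boolPair ν (boolPair σ β)))) u ∈ P.PadBit := by
    change gH _ ∈ P.HeavyLang ∧ (( _ ∧ _) ∧ _) ↔ _
    rw [gH_apply]
    rfl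
  rw [hA, mem_HeavyLang_iff, mem_PadBit_iff]
  constructor
  · rintro ⟨-, hu, ⟨hge, hlt⟩, hpad⟩
    rw [P.mem_GEs_iff w h ν σ β u hP hu (by omega)] at hge
    rw [P.mem_GEs1_iff w h ν σ β u hP hu (by omega)] at hlt
    exact ⟨hu, by omega, hpad⟩
  · rintro ⟨hu, hcnt, hpad⟩
    refine ⟨?_, hu, ⟨?_, ?_⟩, hpad⟩
    · have h1 := P.length_lt_of_mem_stageList hu
      have h2 := nq_lt_Wd hP (boolUnpair w).1 (boolUnpair w).2
      have h3 : wl (boolUnpair w).1 (boolUnpair w).2 ≤ (boolPair w (boolPair h (boolPair ν (boolPair σ β)))).length + 2 := by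
        have := wl_le w; rw [length_boolPair]; omega
      have h4 := P.Wd_mono h3
      simp only [r₁P, eval_comp, eval_add, eval_X, eval_ofNat, eval_WdP]
      omega
    · rw [P.mem_GEs_iff w h ν σ β u hP hu (by omega)]; omega
    · rw [P.mem_GEs1_iff w h ν σ β u hP hu (by omega)]; omega

end LearnLang

end AcProto

end Literature.Barriers.QuantumAdvantage

end

/-! ## Part 2 (`AaronsonChenAdvicePSPACE`): Aaronson–Chen 2017, Lemma 5.3: the advice language is in `PSPACE` given the two physical predicates; Lemma 5.3 from them

Third of three files on `AcProto.advLang ∈ PSPACE` (see `AaronsonChenAdviceMaps.lean`,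
`AaronsonChenAdviceLearn.lean`). Here the sampling and output phases and the assembly:

* over `q = ⟨⟨w, ⟨h, τ⟩⟩, Y⟩`: `gC ⁻¹' CdfLang` (`Y` is selected: `r/2^{|r|} <` cumulative Born weight
  up to `Y`), `MinLang` (no smaller label of the same length is selected — a bounded `∀` over
  `ImpLang = Guardᶜ ∪ (gC' ⁻¹' CdfLang)ᶜ`; `mem_MinLang_iff`), the bit tests `BitS` (bit `|τ|` of `Y`)
  and `BitO` (bit `|τ|` of `padBlock Wo (post Y)`, `post ∈ FP`); `ASLang`, `AOLang`, and
  **`SampLang`**, **`OutLang`** (`∃ᵖ Y · …`) in `PSPACE` with their semantics (`mem_SampLang_iff`,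
  `mem_OutLang_iff`: "the sample — the least selected label, `AcProto.IsSample`,
  `ofFn_ySample_eq_iff` — has bit `|τ|` set", resp. its post-processed padded block);
* `advDecomp` — even `|h|`, and by the phase of `j = |h|/2` the bit language of the phase on the
  sub-instance; **`advLang_eq_advDecomp`** (from `AcProto.advBit_eq_true_iff`) and
  **`advLang_mem_PSPACE`**: `advLang ∈ PSPACE` for bounded protocol data with `post ∈ FP`, given
  `HeavyLang ∈ PSPACE` and `CdfLang ∈ PSPACE` (the complete set for the unions/intersections is the
  tree's `SPACETMSAT`, `exists_isComplete_PSPACE_holds`);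
* **`aaronsonChen2017_lem53_of_physics`**: Lemma 5.3 (`aaronsonChen2017_lem53`) from
  `IsHard PSPACE TQBF` (Stockmeyer–Meyer, the hardness half of the tree's named fact
  `TQBF_isComplete_PSPACE`) and the `PSPACE`-membership of the two physical predicates for bounded
  protocol data — through `aaronsonChen2017_lem53_of_advice` (`AaronsonChenMachine.lean`) and the
  proved halves of the printed proof. What remains of "all the computations can be done in PSPACE"
  is thus exactly: the heavy-tail test `1/a ≤ Q(1u)` and the cumulative-distribution comparison
  `r/2^m < Σ_{y ≤ Y} |⟨y|V|x₀0^m⟩|²` for Clifford+T circuits with `TQBF ⊕ table` query gates are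
  `PSPACE` predicates (exact `ℤ[√2]/2^j` path-pair counting, `QuantumComplexity/OraclePathSums.lean`).

## References

* [AaronsonChen2017] arXiv:1612.05903, Lemma 5.3 and §5.3 (pp. 21–23).
* [KnuthTAOCP2] §3.4.1 A (the inversion method), as in `InverseCdfSampling.lean`.
* [AroraBarakCC2009] Thm. 4.13 (`TQBF` is `PSPACE`-complete).
-/

noncomputable section

namespace Literature.Barriers.QuantumAdvantage

open MeasureTheory _root_.Computability Polynomial Literature.Computability.Complexity
  Literature.Computability.Complexity.Brick Literature.Computability.Complexity.Plumb
  Literature.Computability.Complexity.OracleCompose Literature.Computability.Complexity.PRelSigma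
  Literature.Computability.Complexity.TTClosure Literature.Computability.Complexity.StrEq
  Literature.Computability.Cryptography

namespace AcProto

variable (P : AcProto)

/-! ### The sampling and output phases: instances `q = ⟨inst, Y⟩`, `inst = ⟨w, ⟨h, τ⟩⟩` -/

section SampleLang

variable {B : Language Bool}

/-- `τ` of `⟨⟨w, ⟨h, τ⟩⟩, Y⟩`. [folklore] -/
def τ2 : List Bool → List Bool := sndP ∘ sndP ∘ fstP

/-- `τ2 ∈ FP`. [folklore] -/
theorem τ2_mem_FP : τ2 ∈ FP := comp_mem_FP sndP_mem_FP (comp_mem_FP sndP_mem_FP fstP_mem_FP)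

/-- `1^{Wo(wl)}` of `⟨⟨w, …⟩, Y⟩`, the output block width of the schedule of `w`. [folklore] -/
def WoY : List Bool → List Bool := polyFn P.WoP ∘ pairFn (fstP ∘ wY) (sndP ∘ wY)

/-- `WoY ∈ FP`. [folklore] -/
theorem WoY_mem_FP : P.WoY ∈ FP :=
  comp_mem_FP (polyFn_mem_FP _) (pairFn_mem_FP (comp_mem_FP fstP_mem_FP wY_mem_FP) (comp_mem_FP sndP_mem_FP wY_mem_FP))

/-- The `CdfLang` instance `⟨w, ⟨h, Y⟩⟩` of `⟨inst, Y⟩`. [folklore] -/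
def gC : List Bool → List Bool := pairFn wY (pairFn hY sndP)

/-- `gC ∈ FP`. [folklore] -/
theorem gC_mem_FP : gC ∈ FP := pairFn_mem_FP wY_mem_FP (pairFn_mem_FP hY_mem_FP sndP_mem_FP)

/-- The `CdfLang` instance `⟨w, ⟨h, Y'⟩⟩` of a triple `⟨⟨inst, Y⟩, Y'⟩`. [folklore] -/
def gC' : List Bool → List Bool := pairFn (wY ∘ fstP) (pairFn (hY ∘ fstP) sndP)

/-- `gC' ∈ FP`. [folklore] -/
theorem gC'_mem_FP : gC' ∈ FP :=
  pairFn_mem_FP (comp_mem_FP wY_mem_FP fstP_mem_FP) (pairFn_mem_FP (comp_mem_FP hY_mem_FP fstP_mem_FP) sndP_mem_FP)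

/-- The guard of the minimality test on a triple `⟨⟨inst, Y⟩, Y'⟩`: `|Y'| = |Y|` and `⟦Y'⟧ < ⟦Y⟧`. [folklore] -/
def GuardT : Language Bool :=
  {t | eqPairFn (pairFn (onesFn ∘ sndP) (onesFn ∘ sndP ∘ fstP) t) = [true]} ⊓ {t | ltFn (pairFn sndP (sndP ∘ fstP) t) = [true]}

/-- Membership in `GuardT`. [folklore] -/
theorem mem_GuardT_iff (t : List Bool) :
    t ∈ GuardT ↔ (sndP t).length = (sndP (fstP t)).length ∧ bitsToNat (sndP t) < bitsToNat (sndP (fstP t)) := by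
  change eqPairFn (pairFn (onesFn ∘ sndP) (onesFn ∘ sndP ∘ fstP) t) = [true] ∧ ltFn (pairFn sndP (sndP ∘ fstP) t) = [true] ↔ _
  simp only [Function.comp_apply, pairFn_apply, eqPairFn_boolPair, ltFn_boolPair, onesFn_apply, List.cons.injEq,
    and_true, decide_eq_true_eq]
  constructor
  · rintro ⟨h1, h2⟩
    exact ⟨by simpa using congrArg List.length h1, h2⟩
  · rintro ⟨h1, h2⟩
    exact ⟨by rw [h1], h2⟩

/-- `GuardT ∈ P`. [folklore] -/
theorem GuardT_mem_P : GuardT ∈ Classes.P := by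
  refine inter_mem_P ?_ ?_
  · refine mem_P_of_mem_FP (comp_mem_FP eqPairFn_mem_FP (pairFn_mem_FP (comp_mem_FP onesFn_mem_FP sndP_mem_FP)
      (comp_mem_FP onesFn_mem_FP (comp_mem_FP sndP_mem_FP fstP_mem_FP)))) _ fun t => ⟨fun h => h, fun h => ?_⟩
    have h' : ¬ eqPairFn (pairFn (onesFn ∘ sndP) (onesFn ∘ sndP ∘ fstP) t) = [true] := h
    simp only [Function.comp_apply, pairFn_apply, eqPairFn_boolPair] at h' ⊢
    simpa using h'
  · refine mem_P_of_mem_FP (comp_mem_FP ltFn_mem_FP (pairFn_mem_FP sndP_mem_FP (comp_mem_FP sndP_mem_FP fstP_mem_FP))) _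
      fun t => ⟨fun h => h, fun h => ?_⟩
    have h' : ¬ ltFn (pairFn sndP (sndP ∘ fstP) t) = [true] := h
    simp only [Function.comp_apply, pairFn_apply, ltFn_boolPair] at h' ⊢
    simpa using h'

/-- The implication tested for every `Y'`: if `Y'` is a smaller label of the same length then it is
not selected. [folklore] -/
def ImpLang : Language Bool := GuardTᶜ ⊔ (gC' ⁻¹' P.CdfLang)ᶜ

/-- `ImpLang ∈ PSPACE`. [folklore] -/
theorem ImpLang_mem_PSPACE (hC : P.CdfLang ∈ PSPACE) : P.ImpLang ∈ PSPACE :=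
  union_P_mem_PSPACE (compl_mem_P_iff.2 GuardT_mem_P) (compl_mem_PSPACE (preimage_mem_PSPACE hC gC'_mem_FP))

/-- **Minimality** on `⟨inst, Y⟩`: no smaller label of the same length is selected. [folklore] -/
def MinLang : Language Bool := {q | ∀ Y' : List Bool, Y'.length ≤ (X : Polynomial ℕ).eval q.length → boolPair q Y' ∈ P.ImpLang}

/-- `MinLang ∈ PSPACE` (bounded `∀`). [folklore] -/
theorem MinLang_mem_PSPACE (hC : P.CdfLang ∈ PSPACE) : P.MinLang ∈ PSPACE := polyForall_mem_PSPACE (P.ImpLang_mem_PSPACE hC) X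

variable (w h τ Y : List Bool)

/-- Semantics of `MinLang`. [folklore] -/
theorem mem_MinLang_iff : boolPair (boolPair w (boolPair h τ)) Y ∈ P.MinLang ↔
    ∀ Y' : List Bool, Y'.length = Y.length → bitsToNat Y' < bitsToNat Y → boolPair w (boolPair h Y') ∉ P.CdfLang := by
  have key : ∀ Y' : List Bool, boolPair (boolPair (boolPair w (boolPair h τ)) Y) Y' ∈ P.ImpLang ↔
      ((Y'.length = Y.length ∧ bitsToNat Y' < bitsToNat Y) → boolPair w (boolPair h Y') ∉ P.CdfLang) := by
    intro Y'
    change (_ ∉ GuardT ∨ ¬ gC' _ ∈ P.CdfLang) ↔ _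
    rw [mem_GuardT_iff]
    simp only [sndP_boolPair, fstP_boolPair, gC', pairFn_apply, Function.comp_apply, wY, hY]
    tauto
  change (∀ Y' : List Bool, Y'.length ≤ (X : Polynomial ℕ).eval (List.length (boolPair (boolPair w (boolPair h τ)) Y)) →
    boolPair (boolPair (boolPair w (boolPair h τ)) Y) Y' ∈ P.ImpLang) ↔ _
  simp only [key, eval_X]
  constructor
  · intro H Y' hl hlt
    exact H Y' (by rw [hl, length_boolPair]; omega) ⟨hl, hlt⟩
  · intro H Y' _ hc
    exact H Y' hc.1 hc.2

/-- **The sample bit** on `⟨⟨w, ⟨h, τ⟩⟩, Y⟩`: bit `|τ|` of `Y`. [folklore] -/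
def BitS : Language Bool := {q | (sndP q).getD (τ2 q).length false = true}

/-- **The output bit** on `⟨⟨w, ⟨h, τ⟩⟩, Y⟩`: bit `|τ|` of the padded output block `padBlock Wo (post Y)`. [folklore] -/
def BitO : Language Bool := {q | (padFn P.WoY (P.post ∘ sndP) q).getD (τ2 q).length false = true}

/-- `BitS ∈ P`. [folklore] -/
theorem BitS_mem_P : BitS ∈ Classes.P := setOf_getD_mem_P τ2_mem_FP sndP_mem_FP

/-- `BitO ∈ P` when `post ∈ FP`. [folklore] -/
theorem BitO_mem_P (hpost : P.post ∈ FP) : P.BitO ∈ Classes.P :=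
  setOf_getD_mem_P τ2_mem_FP (padFn_mem_FP P.WoY_mem_FP (comp_mem_FP hpost sndP_mem_FP))

/-- **The sampling relation** `A_S = CdfPre ∩ Min ∩ BitS` and **the output relation**
`A_O = CdfPre ∩ Min ∩ BitO`. [folklore] -/
def ASLang : Language Bool := gC ⁻¹' P.CdfLang ⊓ (P.MinLang ⊓ BitS)

/-- The output relation. [folklore] -/
def AOLang : Language Bool := gC ⁻¹' P.CdfLang ⊓ (P.MinLang ⊓ P.BitO)

/-- `A_S ∈ PSPACE`. [folklore] -/
theorem ASLang_mem_PSPACE (hB : IsComplete PSPACE B) (hC : P.CdfLang ∈ PSPACE) : P.ASLang ∈ PSPACE :=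
  inter_mem_PSPACE_of_complete hB (preimage_mem_PSPACE hC gC_mem_FP)
    (inter_mem_PSPACE_of_complete hB (P.MinLang_mem_PSPACE hC) (P_subset_PSPACE_holds BitS_mem_P))

/-- `A_O ∈ PSPACE`. [folklore] -/
theorem AOLang_mem_PSPACE (hB : IsComplete PSPACE B) (hC : P.CdfLang ∈ PSPACE) (hpost : P.post ∈ FP) :
    P.AOLang ∈ PSPACE :=
  inter_mem_PSPACE_of_complete hB (preimage_mem_PSPACE hC gC_mem_FP)
    (inter_mem_PSPACE_of_complete hB (P.MinLang_mem_PSPACE hC) (P_subset_PSPACE_holds (P.BitO_mem_P hpost)))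

/-- **The sampling-phase bit language** on `⟨w, ⟨h, τ⟩⟩`: the sample has bit `|τ|` set. [folklore] -/
def SampLang : Language Bool := {inst | ∃ Y : List Bool, Y.length ≤ P.r₁P.eval inst.length ∧ boolPair inst Y ∈ P.ASLang}

/-- **The output-phase bit language** on `⟨w, ⟨h, τ⟩⟩`: `padBlock Wo (post sample)` has bit `|τ|` set. [folklore] -/
def OutLang : Language Bool := {inst | ∃ Y : List Bool, Y.length ≤ P.r₁P.eval inst.length ∧ boolPair inst Y ∈ P.AOLang}

/-- `SampLang ∈ PSPACE`. [folklore] -/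
theorem SampLang_mem_PSPACE (hB : IsComplete PSPACE B) (hC : P.CdfLang ∈ PSPACE) : P.SampLang ∈ PSPACE :=
  polyExists_mem_PSPACE (P.ASLang_mem_PSPACE hB hC) _

/-- `OutLang ∈ PSPACE`. [folklore] -/
theorem OutLang_mem_PSPACE (hB : IsComplete PSPACE B) (hC : P.CdfLang ∈ PSPACE) (hpost : P.post ∈ FP) :
    P.OutLang ∈ PSPACE :=
  polyExists_mem_PSPACE (P.AOLang_mem_PSPACE hB hC hpost) _

/-- `IsSample` in terms of `CdfLang` and minimality. [folklore] -/
theorem isSample_iff_cdf : P.IsSample (boolUnpair w).1 (boolUnpair w).2 h Y ↔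
    boolPair w (boolPair h Y) ∈ P.CdfLang ∧
      ∀ Y' : List Bool, Y'.length = Y.length → bitsToNat Y' < bitsToNat Y → boolPair w (boolPair h Y') ∉ P.CdfLang := by
  unfold IsSample
  rw [mem_CdfLang_iff, and_assoc]
  refine and_congr_right fun hl => and_congr_right fun _ => forall_congr' fun Y' => ?_
  rw [mem_CdfLang_iff]
  constructor
  · intro H h1 h2 ⟨_, hs⟩; exact H h1 h2 hs
  · intro H h1 h2 hs; exact H h1 h2 ⟨by rw [h1, hl], hs⟩

/-- The sample fits the witness length. [folklore] -/
theorem length_le_r₁P_of_isSample (hP : P.IsBounded) {Y : List Bool}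
    (hY : P.IsSample (boolUnpair w).1 (boolUnpair w).2 h Y) :
    Y.length ≤ P.r₁P.eval (boolPair w (boolPair h τ)).length := by
  have h1 := hY.1
  have h2 := nq_lt_Wd hP (boolUnpair w).1 (boolUnpair w).2
  have h3 : wl (boolUnpair w).1 (boolUnpair w).2 ≤ (boolPair w (boolPair h τ)).length + 2 := by
    have := wl_le w; rw [length_boolPair]; omega
  have h4 := P.Wd_mono h3
  simp only [r₁P, eval_comp, eval_add, eval_X, eval_ofNat, eval_WdP]
  omega

/-- **Semantics of `SampLang`.** [folklore] -/
theorem mem_SampLang_iff (hP : P.IsBounded) :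
    boolPair w (boolPair h τ) ∈ P.SampLang ↔
      ∃ Y, P.IsSample (boolUnpair w).1 (boolUnpair w).2 h Y ∧ Y.getD τ.length false = true := by
  change (∃ Y : List Bool, Y.length ≤ P.r₁P.eval (boolPair w (boolPair h τ)).length ∧ boolPair _ Y ∈ P.ASLang) ↔ _
  refine exists_congr fun Y => ?_
  have hA : boolPair (boolPair w (boolPair h τ)) Y ∈ P.ASLang ↔
      boolPair w (boolPair h Y) ∈ P.CdfLang ∧ (boolPair (boolPair w (boolPair h τ)) Y ∈ P.MinLang ∧
        Y.getD τ.length false = true) := by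
    have e1 : gC (boolPair (boolPair w (boolPair h τ)) Y) = boolPair w (boolPair h Y) := by
      simp [gC, wY, hY, pairFn_apply]
    have e2 : (sndP (boolPair (boolPair w (boolPair h τ)) Y)).getD (τ2 (boolPair (boolPair w (boolPair h τ)) Y)).length false =
        Y.getD τ.length false := by
      simp [τ2]
    change gC _ ∈ P.CdfLang ∧ (_ ∧ (sndP _).getD (τ2 _).length false = true) ↔ _
    rw [e1, e2]
    exact Iff.rfl
  rw [hA, mem_MinLang_iff, isSample_iff_cdf]
  constructor
  · rintro ⟨-, hc, hmin, hb⟩; exact ⟨⟨hc, hmin⟩, hb⟩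
  · rintro ⟨hs, hb⟩
    exact ⟨P.length_le_r₁P_of_isSample w h τ hP ((P.isSample_iff_cdf w h Y).2 hs), hs.1, hs.2, hb⟩

/-- Value of `WoY` on a pair. [folklore] -/
theorem WoY_apply : P.WoY (boolPair (boolPair w (boolPair h τ)) Y) = ones (P.Wo (wl (boolUnpair w).1 (boolUnpair w).2)) := by
  simp [WoY, wY, wl, pairFn_apply]
  rfl

/-- **Semantics of `OutLang`.** [folklore] -/
theorem mem_OutLang_iff (hP : P.IsBounded) :
    boolPair w (boolPair h τ) ∈ P.OutLang ↔
      ∃ Y, P.IsSample (boolUnpair w).1 (boolUnpair w).2 h Y ∧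
        (padBlock (P.Wo (wl (boolUnpair w).1 (boolUnpair w).2)) (P.post Y)).getD τ.length false = true := by
  change (∃ Y : List Bool, Y.length ≤ P.r₁P.eval (boolPair w (boolPair h τ)).length ∧ boolPair _ Y ∈ P.AOLang) ↔ _
  refine exists_congr fun Y => ?_
  have hA : boolPair (boolPair w (boolPair h τ)) Y ∈ P.AOLang ↔
      boolPair w (boolPair h Y) ∈ P.CdfLang ∧ (boolPair (boolPair w (boolPair h τ)) Y ∈ P.MinLang ∧
        (padBlock (P.Wo (wl (boolUnpair w).1 (boolUnpair w).2)) (P.post Y)).getD τ.length false = true) := by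
    have e1 : gC (boolPair (boolPair w (boolPair h τ)) Y) = boolPair w (boolPair h Y) := by
      simp [gC, wY, hY, pairFn_apply]
    have e2 : (padFn P.WoY (P.post ∘ sndP) (boolPair (boolPair w (boolPair h τ)) Y)).getD
        (τ2 (boolPair (boolPair w (boolPair h τ)) Y)).length false =
        (padBlock (P.Wo (wl (boolUnpair w).1 (boolUnpair w).2)) (P.post Y)).getD τ.length false := by
      rw [padFn_apply, WoY_apply, length_ones_eq]
      simp [τ2]
    change gC _ ∈ P.CdfLang ∧ (_ ∧ (padFn P.WoY (P.post ∘ sndP) _).getD (τ2 _).length false = true) ↔ _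
    rw [e1, e2]
    exact Iff.rfl
  rw [hA, mem_MinLang_iff, isSample_iff_cdf]
  constructor
  · rintro ⟨-, hc, hmin, hb⟩; exact ⟨⟨hc, hmin⟩, hb⟩
  · rintro ⟨hs, hb⟩
    exact ⟨P.length_le_r₁P_of_isSample w h τ hP ((P.isSample_iff_cdf w h Y).2 hs), hs.1, hs.2, hb⟩

end SampleLang

/-! ### The advice language assembled -/

section Assembly

variable {B : Language Bool}

/-- **The three phases put together**: even number of answers, and by the phase of `j = |h|/2` the
corresponding bit language on the corresponding instance. [folklore] -/
def advDecomp : Language Bool :=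
  (sndP ⁻¹' EvenLen) ⊓ ((P.GLearn ⊓ P.instL ⁻¹' P.LearnLang) ⊔
    ((((P.GLearn)ᶜ ⊓ P.GBelowOut) ⊓ P.instS ⁻¹' P.SampLang) ⊔ ((P.GBelowOut)ᶜ ⊓ P.instO ⁻¹' P.OutLang)))

/-- **`advDecomp ∈ PSPACE`** given the two physical predicates (and `post ∈ FP`). [folklore] -/
theorem advDecomp_mem_PSPACE (hB : IsComplete PSPACE B) (hpost : P.post ∈ FP) (hH : P.HeavyLang ∈ PSPACE)
    (hC : P.CdfLang ∈ PSPACE) : P.advDecomp ∈ PSPACE :=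
  inter_P_mem_PSPACE (preimage_mem_P EvenLen_mem_P sndP_mem_FP)
    (union_mem_PSPACE_of_complete hB
      (inter_P_mem_PSPACE P.GLearn_mem_P (preimage_mem_PSPACE (P.LearnLang_mem_PSPACE hB hH) P.instL_mem_FP))
      (union_mem_PSPACE_of_complete hB
        (inter_P_mem_PSPACE (inter_mem_P (compl_mem_P_iff.2 P.GLearn_mem_P) P.GBelowOut_mem_P)
          (preimage_mem_PSPACE (P.SampLang_mem_PSPACE hB hC) P.instS_mem_FP))
        (inter_P_mem_PSPACE (compl_mem_P_iff.2 P.GBelowOut_mem_P)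
          (preimage_mem_PSPACE (P.OutLang_mem_PSPACE hB hC hpost) P.instO_mem_FP))))

/-- Membership in `advDecomp`, spelled out. [folklore] -/
theorem mem_advDecomp_iff (z : List Bool) :
    z ∈ P.advDecomp ↔ (sndP z).length % 2 = 0 ∧ ((z ∈ P.GLearn ∧ P.instL z ∈ P.LearnLang) ∨
      (((z ∉ P.GLearn ∧ z ∈ P.GBelowOut) ∧ P.instS z ∈ P.SampLang) ∨ (z ∉ P.GBelowOut ∧ P.instO z ∈ P.OutLang))) :=
  Iff.rfl

/-- The slots of a stage are a positive number of bits. [folklore] -/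
theorem Sm_mul_Wd_pos (m : ℕ) : 0 < P.Sm m * P.Wd m := by
  refine Nat.mul_pos ?_ (by unfold Wd; omega)
  unfold Sm; positivity

/-- **The advice language is the assembled language.** [cite: AaronsonChen2017, §5.3 (pp. 22–23)] -/
theorem advLang_eq_advDecomp (hP : P.IsBounded) : P.advLang = P.advDecomp := by
  ext z
  change P.advBit (fstP (fstP z)) (sndP (fstP z)) (sndP z) = true ↔ z ∈ P.advDecomp
  rw [P.advBit_eq_true_iff, mem_advDecomp_iff]
  by_cases hpar : (sndP z).length % 2 = 0
  · have hj : jOf z = (sndP z).length / 2 := by unfold jOf; omega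
    have hmm : mmOf z = wl (fstP (fstP z)) (sndP (fstP z)) := rfl
    have hlt : (sndP z).length / 2 % (P.Sm (mmOf z) * P.Wd (mmOf z)) < P.Wd (mmOf z) * P.Sm (mmOf z) :=
      calc (sndP z).length / 2 % (P.Sm (mmOf z) * P.Wd (mmOf z)) < P.Sm (mmOf z) * P.Wd (mmOf z) :=
            Nat.mod_lt _ (P.Sm_mul_Wd_pos _)
        _ = P.Wd (mmOf z) * P.Sm (mmOf z) := mul_comm _ _
    have hs : ((sndP z).length / 2 % (P.Sm (mmOf z) * P.Wd (mmOf z)) / P.Wd (mmOf z)) + 1 ≤ P.Sm (mmOf z) :=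
      Nat.succ_le_of_lt (Nat.div_lt_of_lt_mul hlt)
    simp only [hpar, true_and]
    rw [mem_GLearn_iff, mem_GBelowOut_iff, instL_apply, instS_apply, instO_apply, hj,
      P.mem_LearnLang_iff (fstP z) (sndP z) _ _ _ hP (by rw [length_ones_eq]; exact hs),
      P.mem_SampLang_iff (fstP z) (sndP z) _ hP, P.mem_OutLang_iff (fstP z) (sndP z) _ hP]
    simp only [length_ones_eq, hmm, not_lt, Nat.mod_mul_left_mod]
    change _ ↔ ((_ ∧ _) ∨ (((_ ∧ _) ∧ _) ∨ (_ ∧ _)))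
    simp only [and_assoc]
    rfl
  · simp only [hpar, false_and]

/-- **The advice language is in `PSPACE` given the two physical predicates**: `HeavyLang` (is `u`
queried at stage `n` given the history?) and `CdfLang` (is `r/2^{|r|}` below the cumulative Born
weight up to the label `Y`?), for bounded protocol data with `post ∈ FP` — bounded `∃`/`∀`,
preimages, a gap threshold for the rank of the queried string, unions/intersections through a
`PSPACE`-complete set (`SPACETMSAT`, `exists_isComplete_PSPACE_holds`).
[cite: AaronsonChen2017, §5.3 (p. 23, "all the computations can be done in PSPACE")] -/
theorem advLang_mem_PSPACE (hP : P.IsBounded) (hpost : P.post ∈ FP) (hH : P.HeavyLang ∈ PSPACE)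
    (hC : P.CdfLang ∈ PSPACE) : P.advLang ∈ PSPACE := by
  obtain ⟨B, hB⟩ := exists_isComplete_PSPACE_holds
  rw [P.advLang_eq_advDecomp hP]
  exact P.advDecomp_mem_PSPACE hB hpost hH hC

end Assembly

end AcProto

/-! ### Lemma 5.3 from the two physical predicates -/

/-- **Lemma 5.3 from the `PSPACE`-hardness of `TQBF` and the two physical `PSPACE` predicates**: if
`TQBF` is `PSPACE`-hard (Stockmeyer–Meyer) and, for bounded protocol data with `F` uniform and `post`
polynomial-time, the heavy/small-table predicate `HeavyLang` and the cumulative-distribution predicate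
`CdfLang` of the simulator's replaced run are in `PSPACE` (the polynomial-space evaluation of
Clifford+T circuits with `TQBF ⊕ table` query gates: exact comparisons of `ℤ[√2]/2^j` path-pair
counts), then `aaronsonChen2017_lem53` holds — through `advLang_mem_PSPACE`,
`aaronsonChen2017_lem53_of_advice`, and the proved halves of the printed proof.
[cite: AaronsonChen2017, Lemma 5.3 (p. 21; proof pp. 21–23)] [cite: AroraBarakCC2009, Thm. 4.13] -/
theorem aaronsonChen2017_lem53_of_physics (hT : IsHard PSPACE TQBF)
    (hphys : ∀ P : AcProto, P.F.IsUniform → P.post ∈ FP → P.IsBounded →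
      P.HeavyLang ∈ PSPACE ∧ P.CdfLang ∈ PSPACE) :
    aaronsonChen2017_lem53 :=
  aaronsonChen2017_lem53_of_advice hT fun P hU hpost hP =>
    P.advLang_mem_PSPACE hP hpost (hphys P hU hpost hP).1 (hphys P hU hpost hP).2

end Literature.Barriers.QuantumAdvantage

end
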